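import Literature.IUT.HodgeTheaters.FrobenioidBridgeModels
import Literature.IUT.HodgeTheaters.BaseHodgeTheatersProofs2
import HarnessLib

/-!
# Proofs for the Frobenioid-level bridge models ([IUTchI] Example 5.4 (iii)–(v), pp. 147–149) — abc-iut cell,
# layer L5 (discharge of `FrobenioidBridgeModels.lean`)

Mochizuki, *Inter-universal Teichmüller theory I*, §5 (kurims May-2020 manuscript). Over ANY stub `S : S5Local 𝔡`:
* `FPolyHomNF.under_eq_conj`: the poly-morphism `‡𝒟 → †𝒟^⊚` induced by `‡ℱ ⥲ †ℱ^⊚|_δ` (Ex. 5.4 (iv); DEFINED in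
  `FrobenioidBridgeModels.lean` as the `φ^NF`-type morphisms pulling `δ` back to the class labeled `1`) is, for
  `δ = δ₀(g·[ε])`, the transport along `δ₀` of the model `φ^NF_{g⁻¹}` — so it has exactly the shape the lifting
  condition of Def. 5.5 (i)(d) (`NFBridge.under_isModel`) asks for;
  (whence NF-bridges / ΘNF-Hodge theaters EXIST over every stub: `ThetaNFHodgeTheatersProofs.lean`);
* `ex54iii_holds`: Example 5.4 (iii), the intrinsic description of `δ`-valuations ("[one verifies immediately that] a
  `δ`-valuation may be defined as a valuation that lies in the 'image' via `†φ^NF_⋆` of the unique `†𝒟_j` such that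
  … maps `δ` to the element … labeled `1`", p. 148), PROVED from the three `valOfNF` laws of the stub: for
  `δ = δ₀(g·[ε])` the strip is the one of label `g⁻¹`.
All by the normal forms of `BaseHodgeTheatersProofs2.lean`. Proof-only companion; record-only,
[claim: Mochizuki2012, status: disputed]; nothing here takes a side.
-/

namespace Literature.IUT.HodgeTheaters

open CategoryTheory

universe u

namespace BaseThetaDatum

variable {𝔡 : BaseThetaDatum.{u}}

/-- Transport of valuations along the inverse isomorphism. [claim: Mochizuki2012, status: disputed] -/
theorem valIso_symm {Y Y' : 𝔡.AmbG} (b : Y ≅ Y') : 𝔡.valIso b.symm = (𝔡.valIso b).symm := by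
  have h : (𝔡.valIso b).trans (𝔡.valIso b.symm) = Equiv.refl _ := by
    rw [← 𝔡.valIso_trans, Iso.self_symm_id, 𝔡.valIso_refl]
  ext c
  have := congrArg (fun e : 𝔡.Val Y ≃ 𝔡.Val Y => e ((𝔡.valIso b).symm c)) h
  simpa using this

/-- An automorphism of `𝒟^⊚` translating global label classes by `g⁻¹` has label `g` (labels are read off the
contravariant action). [claim: Mochizuki2012, status: disputed] -/
theorem autLabel_eq_of_labIsoG_eq_inv_smul {u : 𝔡.DG ≅ 𝔡.DG} {g : FlStar 𝔡.l}
    (hu : ∀ c : 𝔡.LabCuspG 𝔡.DG, 𝔡.labIsoG u c = g⁻¹ • c) : autLabel u = g :=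
  autLabel_eq_of_forall u fun c => by rw [Equiv.symm_apply_eq, hu, smul_smul, inv_mul_cancel, one_smul]

/-- Every global label class of an isomorph `†𝒟^⊚` exhibited by `δ₀ : 𝒟^⊚ ⥲ †𝒟^⊚` is `δ₀(g·[ε])` for a unique
`g ∈ F_l^⋇`. [claim: Mochizuki2012, status: disputed] -/
theorem exists_eq_labIsoG_smul_εLab {Y : 𝔡.AmbG} (δ₀ : 𝔡.DG ≅ Y) (δ : 𝔡.LabCuspG Y) :
    ∃ g : FlStar 𝔡.l, δ = 𝔡.labIsoG δ₀ (g • 𝔡.εLab) := by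
  obtain ⟨g, hg, -⟩ := (𝔡.isTorsor_labCuspG 𝔡.DG).existsUnique_smul_eq 𝔡.εLab ((𝔡.labIsoG δ₀).symm δ)
  exact ⟨g, by rw [hg, Equiv.apply_symm_apply]⟩

/-- The `φ^NF`-type morphisms `X → †𝒟^⊚` pulling the class `δ₀(g·[ε])` back to the canonical element (label `1`) are
exactly the transport along `δ₀` of the model `φ^NF_{g⁻¹}`. [claim: Mochizuki2012, status: disputed] -/
theorem setOf_labPull_eq_η_eq_conj {v : 𝔡.V} {X : 𝔡.Amb v} {Y : 𝔡.AmbG} (κ : 𝔡.D v ≅ X) (δ₀ : 𝔡.DG ≅ Y)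
    (g : FlStar 𝔡.l) :
    {f : 𝔡.HomNF v X Y | 𝔡.labPull f (𝔡.labIsoG δ₀ (g • 𝔡.εLab)) = 𝔡.η v X} =
      PolyHomNF.conj 𝔡 κ δ₀ (𝔡.phiNFj g⁻¹ v) := by
  ext f
  rw [Set.mem_setOf_eq, mem_conj_phiNFj_iff]
  constructor
  · intro hf
    obtain ⟨a, b', rfl⟩ := 𝔡.exists_eq_phiNF f
    have hb' : b' = (b' ≪≫ δ₀.symm) ≪≫ δ₀ := by rw [Iso.trans_assoc, Iso.symm_self_id, Iso.trans_refl]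
    rw [hb', labPull_normalForm] at hf
    refine ⟨a, b' ≪≫ δ₀.symm, ?_, by rw [← hb']⟩
    have h1 : (autLabel (b' ≪≫ δ₀.symm) * g) • 𝔡.η v X = (1 : FlStar 𝔡.l) • 𝔡.η v X := by rw [hf, one_smul]
    exact eq_inv_of_mul_eq_one_left
      (((𝔡.isTorsor_labCusp v X).existsUnique_smul_eq (𝔡.η v X) _).unique h1 rfl)
  · rintro ⟨α, d, hd, rfl⟩
    rw [labPull_normalForm, hd, inv_mul_cancel, one_smul]

namespace S5Local

variable (S : S5Local 𝔡)

/-- **The induced poly-morphism has `φ^NF`-shape** (Ex. 5.4 (iv)–(v), p. 148–149): for an `ℱ`-prime-strip `‡ℱ`, an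
isomorph `‡ℱ^⊚` whose base is exhibited by `δ₀ : 𝒟^⊚ ⥲ ‡𝒟^⊚`, and the poly-morphism `‡ℱ → ‡ℱ^⊚` given by
`δ = δ₀(g·[ε])`, the induced `‡𝒟_v → ‡𝒟^⊚` is the transport of the model `φ^NF_{g⁻¹}` at `v`.
[claim: Mochizuki2012, status: disputed] -/
theorem FPolyHomNF.under_eq_conj {X : S.FPrimeStrip} {Y : S.FAmbG} (δ₀ : 𝔡.DG ≅ S.baseG Y) (g : FlStar 𝔡.l)
    (v : 𝔡.V) (κ : 𝔡.D v ≅ X.base v) :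
    FPolyHomNF.under (X := X) (𝔡.labIsoG δ₀ (g • 𝔡.εLab)) v = PolyHomNF.conj 𝔡 κ δ₀ (𝔡.phiNFj g⁻¹ v) :=
  setOf_labPull_eq_η_eq_conj κ δ₀ g

/-- **Example 5.4 (iii), intrinsic form, holds** ([IUTchI] p. 148): over any stub `S`, for every `𝒟`-NF-bridge
`†φ^NF_⋆`, `δ ∈ LabCusp(†𝒟^⊚)` and `w ∈ 𝕍(†𝒟^⊚)`: `w` is a `δ`-valuation (maps into `𝕍^{±un}` under the
`Aut_ε`-orbit of isomorphisms `†𝒟^⊚ ⥲ 𝒟^⊚` carrying `δ ↦ [ε]`) iff `w` lies in the image via `†φ^NF_j` of the strip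
`†𝒟_j` whose induced bijection sends `δ` to the class labeled `1`. [claim: Mochizuki2012, status: disputed] -/
theorem ex54iii_holds : Ex54iii S := by
  intro B δ w
  obtain ⟨ι, κ, δ₀, h⟩ := B.isModel
  obtain ⟨g, rfl⟩ := exists_eq_labIsoG_smul_εLab δ₀ δ
  constructor
  · rintro ⟨b, hb1, b', v₀, hb', hb2⟩
    -- the isomorphism `b ∘ δ₀`, read as an automorphism of `𝒟^⊚`, has label `g`
    have key : 𝔡.labIsoG (δ₀ ≪≫ b) (g • 𝔡.εLab) = 𝔡.εLab := by
      rw [𝔡.labIsoG_trans, Equiv.trans_apply]; exact hb1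
    have hu : autLabel (δ₀ ≪≫ b) = g := by
      refine autLabel_eq_of_forall _ fun c => ?_
      obtain ⟨t, rfl, -⟩ := (𝔡.isTorsor_labCuspG 𝔡.DG).existsUnique_smul_eq 𝔡.εLab c
      rw [Equiv.symm_apply_eq, smul_smul, mul_comm g t, ← smul_smul, 𝔡.labIsoG_smul, key]
    refine ⟨ι g⁻¹, fun v f hf => ?_, v₀,
      𝔡.postNF (𝔡.preNF (Pi.isoApp (κ g⁻¹) v₀).symm (𝔡.phiNF v₀)) ((b' ≪≫ (δ₀ ≪≫ b).symm) ≪≫ δ₀), ?_, ?_⟩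
    · rw [h] at hf
      obtain ⟨α, d, hd, rfl⟩ := (mem_conj_phiNFj_iff _ _ _ _).1 hf
      rw [labPull_normalForm, hd, inv_mul_cancel, one_smul, IsTorsor.labelEquiv_self]
    · rw [h]
      exact (mem_conj_phiNFj_iff _ _ _ _).2
        ⟨_, b' ≪≫ (δ₀ ≪≫ b).symm, by rw [autLabel_trans, autLabel_symm, hb', hu, one_mul], rfl⟩
    · rw [S.valOfNF_postNF, S.valOfNF_preNF, S.valOfNF_phiNF, Iso.trans_symm, Iso.trans_assoc, Iso.trans_assoc,
        Iso.symm_self_id, Iso.trans_refl, 𝔡.valIso_trans, Equiv.trans_apply, valIso_symm, Equiv.symm_apply_eq]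
      exact hb2.symm
  · rintro ⟨j, h1, v, f, hf, rfl⟩
    obtain ⟨κ₁⟩ := 𝔡.nonempty_iso v (𝔡.D v) (B.capsule j v)
    have hf' := hf
    rw [B.poly_eq_conj h j v κ₁] at hf'
    obtain ⟨α, d, hd, rfl⟩ := (mem_conj_phiNFj_iff _ _ _ _).1 hf'
    have hlab := h1 v _ hf
    rw [labPull_normalForm, IsTorsor.labelEquiv_smul_self] at hlab
    obtain ⟨u, hu⟩ := 𝔡.exists_aut_smul g⁻¹
    have hul : autLabel u = g := autLabel_eq_of_labIsoG_eq_inv_smul hu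
    refine ⟨δ₀.symm ≪≫ u, ?_, d ≪≫ u, v, ?_, ?_⟩
    · rw [𝔡.labIsoG_trans, Equiv.trans_apply, labIsoG_symm, Equiv.symm_apply_apply, hu, smul_smul,
        inv_mul_cancel, one_smul]
    · rw [autLabel_trans, hul]; exact hlab
    · rw [S.valOfNF_postNF, S.valOfNF_preNF, S.valOfNF_phiNF]
      have : 𝔡.valIso (δ₀.symm ≪≫ u) (𝔡.valIso (d ≪≫ δ₀) (𝔡.valOfV v)) =
          𝔡.valIso ((d ≪≫ δ₀) ≪≫ (δ₀.symm ≪≫ u)) (𝔡.valOfV v) := by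
        rw [𝔡.valIso_trans (d ≪≫ δ₀)]; rfl
      rw [this, Iso.trans_assoc, Iso.self_symm_id_assoc]

/-- `Ex54iii` — `_holds` alias of `ex54iii_holds` above under the fact's exact name (appended
2026-08-28, D-0026 bookkeeping: the proof term is the existing theorem of this file; no statement,
definition or attribute is edited; no new named fact; the ledger's debt table listed the fact
unproved). [claim: Mochizuki2012, status: disputed] -/
theorem _root_.Literature.IUT.HodgeTheaters.BaseThetaDatum.S5Local.Ex54iii_holds : Ex54iii S :=
  _root_.Literature.IUT.HodgeTheaters.BaseThetaDatum.S5Local.ex54iii_holds (S := S)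

end S5Local

end BaseThetaDatum

end Literature.IUT.HodgeTheaters
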